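import Summits.RiemannHypothesis.RiemannHypothesis.Theorems.TiltedLandingLaw421R3MenuThinEdge
import Summits.RiemannHypothesis.RiemannHypothesis.Theorems.TiltedLandingLaw421R3MenuThinQR

/-!
# W-09 · C4 «kernel desk» (rh-idea-6 g46) — «MenuThinTop»: the three DOORS of the `R = 2` menu leaf, K-free and exact

SUPPORT toward crux ⟨stmt-RiemannHypothesis-27010⟩ `…EarlyAppointments.TiltedLandingLaw421RT`.  The one open leaf is #1311's
`RhW08.MenuThinNF.MenuThinCertFormSig (√5/2) (27/256)` (sink #1315 `certificatesExistThinSig_of_kitCertForm`); direction of record (CA1155)(d):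
LIMIT LAW (#1314 `limitDichotomySig_holds`, #1319 `asector_leading_iff`, #1320) + REMAINDER.  This file is the remainder's DOOR: it eliminates the
datum kernel `K = K_v(w)` EXACTLY (no `√`, no division by `Im K`) from the three disjuncts the leaf needs — A-sector(κ), A-half-plane(B) (C3 g59
RESULT-2: indispensable at positive `m`), Ti-half-plane(B) — reducing each to K-FREE boundary families with per-datum constants (`G ≥ g`; `J ≤ j`,
`Dl ≤ d` — C3 g59's anatomy `Φ = Φ⁰·J + Im K²·Dl`, `G = Λ(ih,u)/Λ(w,u)`, mediant split `tG_of_mediant`) plus a polynomial margin in #1319's chart: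
`limTg` (`limTg 1 = limT`), `limAjd` (`limAjd (27/256) 1 0 = limA`), `limHroom`.  Doors ★ `tihp_of_GBound_limTg` (disjunct 4), ★ `asec_of_JDl`
(disjunct 1), ★ `ahp_of_JDl` (disjunct 2; witness `B = Br₁/‖K‖`, room s- and m-free) over the EXACT normal-form binders of the leaf.  This module
defines NO `…Sig` law; the K-free 3-menu reduced leaf and the assembly by name live in the LEAF module «MenuThinLeaf» ((CA1200)(4)).  Nothing here
bears on the truth of RH; the leaf and ⟨27010⟩ stay OPEN.
-/

noncomputable section

namespace RhW08.MenuThinTop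

open RhW08.SinkBdry RhW08.SinkConePos RhW08.MenuThin RhW08.MenuThinNF RhW08.MenuThinQR RhW08.LimitMenu

/-! ## §1 The thin boundary as one predicate; boundary geometry of a legal child -/

/-- the four boundary families of the thin window (`R = 2`: columns `ξ = ±1`, `0 ≤ b ≤ 1 − h`; lid `b = 1 − h`, `|ξ| ≥ 1`) as ONE predicate. -/
def OnThinBdry (h : ℝ) (P : ℝ → ℝ → Prop) : Prop :=
  (∀ b : ℝ, 0 ≤ b → b ≤ 1 - h → P 1 b) ∧ (∀ b : ℝ, 0 ≤ b → b ≤ 1 - h → P (-1) b) ∧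
  (∀ ξ : ℝ, 1 ≤ ξ → P ξ (1 - h)) ∧ (∀ ξ : ℝ, 1 ≤ -ξ → P ξ (1 - h))

/-- monotonicity with the boundary facts `|ξ| ≥ 1`, `0 ≤ b ≤ 1 − h` in hand (`h ≤ 1`). -/
theorem OnThinBdry.mono {h : ℝ} {P P' : ℝ → ℝ → Prop} (hh : h ≤ 1) (hPQ : ∀ ξ b, 1 ≤ |ξ| → 0 ≤ b → b ≤ 1 - h → P ξ b → P' ξ b)
    (hP : OnThinBdry h P) : OnThinBdry h P' := by
  obtain ⟨h1, h2, h3, h4⟩ := hP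
  exact ⟨fun b hb hb' => hPQ 1 b (by simp) hb hb' (h1 b hb hb'), fun b hb hb' => hPQ (-1) b (by simp) hb hb' (h2 b hb hb'),
    fun ξ hξ => hPQ ξ _ (hξ.trans (le_abs_self ξ)) (by linarith) le_rfl (h3 ξ hξ),
    fun ξ hξ => hPQ ξ _ (hξ.trans (neg_le_abs ξ)) (by linarith) le_rfl (h4 ξ hξ)⟩

/-- conjunction of two boundary families. -/
theorem OnThinBdry.and {h : ℝ} {P P' : ℝ → ℝ → Prop} (hP : OnThinBdry h P) (hP' : OnThinBdry h P') :
    OnThinBdry h (fun ξ b => P ξ b ∧ P' ξ b) :=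
  ⟨fun b hb hb' => ⟨hP.1 b hb hb', hP'.1 b hb hb'⟩, fun b hb hb' => ⟨hP.2.1 b hb hb', hP'.2.1 b hb hb'⟩,
    fun ξ hξ => ⟨hP.2.2.1 ξ hξ, hP'.2.2.1 ξ hξ⟩, fun ξ hξ => ⟨hP.2.2.2 ξ hξ, hP'.2.2.2 ξ hξ⟩⟩

/-- #1308's Ti-domination at `R = 2`, lid `1 − h` IS a boundary family. -/
theorem thinBdryDomFormTi_iff (h δ t σ : ℝ) :
    ThinBdryDomFormTi 2 (1 - h) h δ t σ ↔ OnThinBdry h (fun ξ b => topINumForm δ t h ξ b ≤ σ * pairCForm δ t ξ b) := by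
  unfold ThinBdryDomFormTi OnThinBdry; rw [show ((2 : ℝ) / 2) = 1 by norm_num]

/-- #1308's A-domination at `R = 2`, lid `1 − h` IS a boundary family. -/
theorem thinBdryDomFormA_iff (h δ t Y σ : ℝ) :
    ThinBdryDomFormA 2 (1 - h) δ t Y σ ↔ OnThinBdry h (fun ξ b => footANumForm δ t Y ξ b ≤ σ * pairCForm δ t ξ b) := by
  unfold ThinBdryDomFormA OnThinBdry; rw [show ((2 : ℝ) / 2) = 1 by norm_num]

/-- BOUNDARY GEOMETRY of a legal child (`0 ≤ δ < h`): `b² < (δ − ξ)²` at every boundary point (no pole; `cn_w = (δ−ξ)² + t² − b² > 0`). -/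
theorem sq_lt_bdry {h δ ξ b : ℝ} (hδ : 0 ≤ δ) (hδh : δ < h) (hξ : 1 ≤ |ξ|) (hb0 : 0 ≤ b) (hb : b ≤ 1 - h) : b ^ 2 < (δ - ξ) ^ 2 := by
  have h1 : |ξ| - |δ| ≤ |ξ - δ| := abs_sub_abs_le_abs_sub ξ δ
  rw [abs_of_nonneg hδ, abs_sub_comm] at h1
  have := mul_self_lt_mul_self hb0 (show b < |δ - ξ| by linarith)
  rwa [← pow_two, ← pow_two, sq_abs] at this

/-- … and `b² < ξ² + h²` (`cn₁ = ξ² + h² − b² > 0`) when `0 < h`. -/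
theorem sq_lt_top {h ξ b : ℝ} (hh : 0 < h) (hξ : 1 ≤ |ξ|) (hb0 : 0 ≤ b) (hb : b ≤ 1 - h) : b ^ 2 < ξ ^ 2 + h ^ 2 := by
  have h1 : 1 ≤ ξ ^ 2 := by nlinarith [sq_abs ξ, abs_nonneg ξ]
  nlinarith

/-! ## §2 T-SIDE: the Ti-half-plane disjunct through a K-free bound `G ≥ g` -/

/-- (I1) `E₋·E₊ = cn² + 4X²b²` (`E∓ = X² + (t ∓ b)²`, `cn = X² + t² − b²`). -/
theorem denom_prod (X t b : ℝ) : (X ^ 2 + (t - b) ^ 2) * (X ^ 2 + (t + b) ^ 2) = (X ^ 2 + t ^ 2 - b ^ 2) ^ 2 + 4 * X ^ 2 * b ^ 2 := by ring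

/-- `c(u)` in Λ-form off the poles: `pairCForm δ t ξ b = 2t·cn/(cn² + 4(δ−ξ)²b²) = 2t·Λ(w,u)` (#1279 `pairCForm_mul` + (I1)). -/
theorem pairCForm_eq_lam {δ t ξ b : ℝ} (h : b ^ 2 < (δ - ξ) ^ 2 + t ^ 2) :
    pairCForm δ t ξ b = 2 * t * ((δ - ξ) ^ 2 + t ^ 2 - b ^ 2) / (((δ - ξ) ^ 2 + t ^ 2 - b ^ 2) ^ 2 + 4 * (δ - ξ) ^ 2 * b ^ 2) := by
  have hm := pairDenom_pos_sub h; have hp := pairDenom_pos_add h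
  rw [← denom_prod, eq_div_iff (mul_pos hm hp).ne', pairCForm_mul δ t ξ b hm.ne' hp.ne']

/-- ★ T-DOOR, POINTWISE: the product form of `g·Λ(w,u) ≤ Λ(ih,u)` gives `(g·I·h/t)·c_w(u) ≤ I·c_{ih}(u)` for any level factor `I ≥ 0`. -/
theorem tRatio_point {g h δ t ξ b I : ℝ} (ht : 0 < t) (hh : 0 < h) (hI : 0 ≤ I) (hw : b ^ 2 < (δ - ξ) ^ 2 + t ^ 2) (h1 : b ^ 2 < ξ ^ 2 + h ^ 2)
    (hG : g * ((δ - ξ) ^ 2 + t ^ 2 - b ^ 2) * ((ξ ^ 2 + h ^ 2 - b ^ 2) ^ 2 + 4 * ξ ^ 2 * b ^ 2) ≤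
      (ξ ^ 2 + h ^ 2 - b ^ 2) * (((δ - ξ) ^ 2 + t ^ 2 - b ^ 2) ^ 2 + 4 * (δ - ξ) ^ 2 * b ^ 2)) :
    g * I * h / t * pairCForm δ t ξ b ≤ I * pairCForm 0 h ξ b := by
  rw [pairCForm_eq_lam hw, pairCForm_eq_lam (show b ^ 2 < (0 - ξ) ^ 2 + h ^ 2 by rwa [zero_sub, neg_sq])]
  simp only [zero_sub, neg_sq]
  have hcw : 0 < (δ - ξ) ^ 2 + t ^ 2 - b ^ 2 := by linarith
  have hc1 : 0 < ξ ^ 2 + h ^ 2 - b ^ 2 := by linarith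
  have hDw : 0 < ((δ - ξ) ^ 2 + t ^ 2 - b ^ 2) ^ 2 + 4 * (δ - ξ) ^ 2 * b ^ 2 := by positivity
  have hD1 : 0 < (ξ ^ 2 + h ^ 2 - b ^ 2) ^ 2 + 4 * ξ ^ 2 * b ^ 2 := by positivity
  rw [show g * I * h / t * (2 * t * ((δ - ξ) ^ 2 + t ^ 2 - b ^ 2) / (((δ - ξ) ^ 2 + t ^ 2 - b ^ 2) ^ 2 + 4 * (δ - ξ) ^ 2 * b ^ 2)) =
      2 * h * I * (g * ((δ - ξ) ^ 2 + t ^ 2 - b ^ 2) / (((δ - ξ) ^ 2 + t ^ 2 - b ^ 2) ^ 2 + 4 * (δ - ξ) ^ 2 * b ^ 2)) by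
        field_simp,
    show I * (2 * h * (ξ ^ 2 + h ^ 2 - b ^ 2) / ((ξ ^ 2 + h ^ 2 - b ^ 2) ^ 2 + 4 * ξ ^ 2 * b ^ 2)) =
      2 * h * I * ((ξ ^ 2 + h ^ 2 - b ^ 2) / ((ξ ^ 2 + h ^ 2 - b ^ 2) ^ 2 + 4 * ξ ^ 2 * b ^ 2)) by ring]
  exact mul_le_mul_of_nonneg_left (by rw [div_le_div_iff₀ hDw hD1]; linarith) (by positivity)

/-- ★ MEDIANT SPLIT (C3 g59 «T-med», `G ≥ min(cn_w/cn₁, (cn₁/cn_w)(X_w/ξ)²)`): `g·cn₁ ≤ cn_w`, `g·cn_w·ξ² ≤ cn₁(δ−ξ)²` ⇒ product form `G ≥ g`. -/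
theorem tG_of_mediant {g h δ t ξ b : ℝ} (hcw : 0 ≤ (δ - ξ) ^ 2 + t ^ 2 - b ^ 2) (hc1 : 0 ≤ ξ ^ 2 + h ^ 2 - b ^ 2)
    (ha : g * (ξ ^ 2 + h ^ 2 - b ^ 2) ≤ (δ - ξ) ^ 2 + t ^ 2 - b ^ 2)
    (hb : g * ((δ - ξ) ^ 2 + t ^ 2 - b ^ 2) * ξ ^ 2 ≤ (ξ ^ 2 + h ^ 2 - b ^ 2) * (δ - ξ) ^ 2) :
    g * ((δ - ξ) ^ 2 + t ^ 2 - b ^ 2) * ((ξ ^ 2 + h ^ 2 - b ^ 2) ^ 2 + 4 * ξ ^ 2 * b ^ 2) ≤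
      (ξ ^ 2 + h ^ 2 - b ^ 2) * (((δ - ξ) ^ 2 + t ^ 2 - b ^ 2) ^ 2 + 4 * (δ - ξ) ^ 2 * b ^ 2) := by
  have key : (ξ ^ 2 + h ^ 2 - b ^ 2) * (((δ - ξ) ^ 2 + t ^ 2 - b ^ 2) ^ 2 + 4 * (δ - ξ) ^ 2 * b ^ 2) -
      g * ((δ - ξ) ^ 2 + t ^ 2 - b ^ 2) * ((ξ ^ 2 + h ^ 2 - b ^ 2) ^ 2 + 4 * ξ ^ 2 * b ^ 2) =
      ((δ - ξ) ^ 2 + t ^ 2 - b ^ 2) * (ξ ^ 2 + h ^ 2 - b ^ 2) * (((δ - ξ) ^ 2 + t ^ 2 - b ^ 2) - g * (ξ ^ 2 + h ^ 2 - b ^ 2)) +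
        4 * b ^ 2 * ((ξ ^ 2 + h ^ 2 - b ^ 2) * (δ - ξ) ^ 2 - g * ((δ - ξ) ^ 2 + t ^ 2 - b ^ 2) * ξ ^ 2) := by ring
  nlinarith [mul_nonneg (mul_nonneg hcw hc1) (sub_nonneg.2 ha), mul_nonneg (mul_nonneg (by norm_num : (0 : ℝ) ≤ 4) (sq_nonneg b)) (sub_nonneg.2 hb)]

/-- the K-free T-bound family `G ≥ g` on the thin boundary, in product form (fed by `gBoundOn_of_mediant` or by any sharper bound). -/
def GBoundOn (g h δ t : ℝ) : Prop :=
  OnThinBdry h (fun ξ b => g * ((δ - ξ) ^ 2 + t ^ 2 - b ^ 2) * ((ξ ^ 2 + h ^ 2 - b ^ 2) ^ 2 + 4 * ξ ^ 2 * b ^ 2) ≤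
    (ξ ^ 2 + h ^ 2 - b ^ 2) * (((δ - ξ) ^ 2 + t ^ 2 - b ^ 2) ^ 2 + 4 * (δ - ξ) ^ 2 * b ^ 2))

/-- the two mediant families on the thin boundary give `GBoundOn` (legal child `0 ≤ δ < h ≤ 1`). -/
theorem gBoundOn_of_mediant {g h δ t : ℝ} (hh0 : 0 < h) (hh1 : h ≤ 1) (hδ : 0 ≤ δ) (hδh : δ < h)
    (hmed : OnThinBdry h (fun ξ b => g * (ξ ^ 2 + h ^ 2 - b ^ 2) ≤ (δ - ξ) ^ 2 + t ^ 2 - b ^ 2 ∧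
      g * ((δ - ξ) ^ 2 + t ^ 2 - b ^ 2) * ξ ^ 2 ≤ (ξ ^ 2 + h ^ 2 - b ^ 2) * (δ - ξ) ^ 2)) : GBoundOn g h δ t :=
  hmed.mono hh1 fun ξ b hξ hb0 hb hpt =>
    tG_of_mediant (by nlinarith [sq_lt_bdry hδ hδh hξ hb0 hb, sq_nonneg t]) (by linarith [sq_lt_top hh0 hξ hb0 hb]) hpt.1 hpt.2

/-- pointwise Ti-domination from the ratio inequality: `B·c_w ≤ I·c_{ih}` (`I = Im K > 0`) ⇒ `N_Ti(u) ≤ (1 − B/I)·c_w(u)`. -/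
theorem topI_dom_of_ratio {δ t h ξ b B I : ℝ} (hI : 0 < I) (hle : B * pairCForm δ t ξ b ≤ I * pairCForm 0 h ξ b) :
    topINumForm δ t h ξ b ≤ (1 - B / I) * pairCForm δ t ξ b := by
  unfold topINumForm
  have h1 : B / I * pairCForm δ t ξ b ≤ pairCForm 0 h ξ b := by
    rw [div_mul_eq_mul_div, div_le_iff₀ hI]; linarith [mul_comm I (pairCForm 0 h ξ b)]
  nlinarith [h1]

/-- ★★ T-DOOR: a K-free bound `G ≥ g` on ∂ plus ROOM `1/(2s) < g·Im K·h/t` give the Ti-half-plane disjunct at the explicit level `B = g·Im K·h/t`. -/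
theorem tihp_of_GBound {s g h δ t Y : ℝ} (ht : 0 < t) (hh0 : 0 < h) (hh1 : h ≤ 1) (hδ : 0 ≤ δ) (hδh : δ < h) (hIK : 0 < kerIm δ t Y)
    (hG : GBoundOn g h δ t) (hroom : 1 / (2 * s) < g * kerIm δ t Y * h / t) :
    ∃ B : ℝ, 1 / (2 * s) < B ∧ ThinBdryDomFormTi 2 (1 - h) h δ t (1 - B / kerIm δ t Y) := by
  refine ⟨_, hroom, (thinBdryDomFormTi_iff h δ t _).2 (hG.mono hh1 fun ξ b hξ hb0 hb hpt => ?_)⟩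
  have hw : b ^ 2 < (δ - ξ) ^ 2 + t ^ 2 := by nlinarith [sq_lt_bdry hδ hδh hξ hb0 hb, sq_nonneg t]
  exact topI_dom_of_ratio hIK (tRatio_point ht hh0 hIK.le hw (sq_lt_top hh0 hξ hb0 hb) hpt)

/-- the top margin with a G-factor: `T_g(Q,r) = 64·g·(1 − Q) − min(8/(r+1), 1/2)·(Qr + 1)(Q + r)`. -/
def limTg (g Q r : ℝ) : ℝ := 64 * g * (1 - Q) - min (8 / (r + 1)) (1 / 2) * (Q * r + 1) * (Q + r)

/-- `limTg 1 = limT`: #1314's `limT` IS the leading-order top read (`G ≡ 1` at `u = ∞`). -/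
theorem limTg_one (Q r : ℝ) : limTg 1 Q r = limT Q r := by unfold limTg limT; ring

/-- CHART IDENTITY: `Im K·h/t = 2h(1 − Q)/(m²(1 + Qr)(Q + r))` (#1319 `kerIm_QR`; `t = m(r−1)/2`, `r > 1`). -/
theorem room_chart (Q r m δ h : ℝ) (hm : 0 < m) (hr : 1 < r) (hQ : 0 ≤ Q) (hδ : δ ^ 2 = Q * r * m ^ 2) :
    kerIm δ (m * (r - 1) / 2) (m * (r + 1) / 2) * h / (m * (r - 1) / 2) = 2 * h * (1 - Q) / (m ^ 2 * ((1 + Q * r) * (Q + r))) := by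
  rw [kerIm_QR Q r m δ hm (by linarith) hQ hδ]
  have h1 : 0 < 1 + Q * r := by positivity
  have h2 : 0 < Q + r := by positivity
  have h3 : 0 < r - 1 := by linarith
  field_simp

/-- NF ELIMINATION of `(s, h)`: `m < s/4`, `m(r+1) ≤ 2h`, `2s ≤ h`, `0 ≤ T_g(Q,r)` give the ROOM `m²(1+Qr)(Q+r) < 4·s·h·g·(1−Q)` (two `min` cases). -/
theorem room_of_limTg {s h m Q r g : ℝ} (hs : 0 < s) (hsh : 2 * s ≤ h) (hm : 0 < m) (hms : m < s / 4) (hmr : m * (r + 1) ≤ 2 * h)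
    (hr : 1 ≤ r) (hQ : 0 ≤ Q) (hT : 0 ≤ limTg g Q r) : m ^ 2 * ((1 + Q * r) * (Q + r)) < 4 * s * h * g * (1 - Q) := by
  have hh0 : 0 < h := by linarith
  have hX : 0 < (1 + Q * r) * (Q + r) := by
    have : 0 < Q + r := by linarith
    positivity
  unfold limTg at hT
  rcases min_cases (8 / (r + 1)) (1 / 2 : ℝ) with ⟨hmin, _⟩ | ⟨hmin, _⟩ <;> rw [hmin] at hT
  · have hr1 : 0 < r + 1 := by linarith
    have hX8 : 8 * ((1 + Q * r) * (Q + r)) ≤ 64 * g * (1 - Q) * (r + 1) := by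
      rw [show 8 / (r + 1) * (Q * r + 1) * (Q + r) = 8 * ((1 + Q * r) * (Q + r)) / (r + 1) by ring, sub_nonneg, div_le_iff₀ hr1] at hT
      exact hT
    have h1 : m * (m * (r + 1)) < s / 4 * (2 * h) :=
      calc m * (m * (r + 1)) ≤ m * (2 * h) := by gcongr
        _ < s / 4 * (2 * h) := by gcongr
    have h2 := mul_le_mul_of_nonneg_left hX8 (by positivity : (0 : ℝ) ≤ s * h / 16)
    nlinarith [h1, h2, hr1, hX]
  · have hX8 : (1 + Q * r) * (Q + r) ≤ 128 * g * (1 - Q) := by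
      rw [show 1 / 2 * (Q * r + 1) * (Q + r) = (1 + Q * r) * (Q + r) / 2 by ring] at hT
      linarith
    have h1 : m ^ 2 < s * h / 32 := by
      have : m ^ 2 < (s / 4) ^ 2 := by gcongr
      nlinarith [this]
    calc m ^ 2 * ((1 + Q * r) * (Q + r)) < s * h / 32 * ((1 + Q * r) * (Q + r)) := by gcongr
      _ ≤ s * h / 32 * (128 * g * (1 - Q)) := by gcongr
      _ = 4 * s * h * g * (1 - Q) := by ring

/-- T-door in the chart (`t = m(r−1)/2`, `Y = m(r+1)/2`, `δ² = Q r m²`). -/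
theorem tihp_chart {s g h Q r m δ t Y : ℝ} (hs : 0 < s) (hsh : 2 * s ≤ h) (hh1 : h ≤ 1) (hm : 0 < m) (hr : 1 < r) (hQ : 0 ≤ Q)
    (hδ : 0 ≤ δ) (hδh : δ < h) (hδQ : δ ^ 2 = Q * r * m ^ 2) (et : t = m * (r - 1) / 2) (eY : Y = m * (r + 1) / 2) (hms : m < s / 4)
    (hYh : Y ≤ h) (hIK : 0 < kerIm δ t Y) (hG : GBoundOn g h δ t) (hT : 0 ≤ limTg g Q r) :
    ∃ B : ℝ, 1 / (2 * s) < B ∧ ThinBdryDomFormTi 2 (1 - h) h δ t (1 - B / kerIm δ t Y) := by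
  have hh0 : 0 < h := by linarith
  have hr1 : 0 < r - 1 := by linarith
  have ht : 0 < t := by rw [et]; positivity
  have key : kerIm δ t Y * h / t = 2 * h * (1 - Q) / (m ^ 2 * ((1 + Q * r) * (Q + r))) := by
    rw [et, eY]; exact room_chart Q r m δ h hm hr hQ hδQ
  have hX : 0 < m ^ 2 * ((1 + Q * r) * (Q + r)) := by
    have : 0 < Q + r := by linarith
    positivity
  have hlt := room_of_limTg hs hsh hm hms (by rw [eY] at hYh; linarith) hr.le hQ hT
  refine tihp_of_GBound ht hh0 hh1 hδ hδh hIK hG ?_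
  rw [show g * kerIm δ t Y * h / t = g * (kerIm δ t Y * h / t) by ring, key, div_lt_iff₀ (by positivity : (0 : ℝ) < 2 * s),
    show g * (2 * h * (1 - Q) / (m ^ 2 * ((1 + Q * r) * (Q + r)))) * (2 * s) = 4 * s * h * g * (1 - Q) / (m ^ 2 * ((1 + Q * r) * (Q + r))) by ring,
    lt_div_iff₀ hX, one_mul]
  exact hlt

/-- ★★★ T-DOOR OF RECORD over the NF binders: `G ≥ g` on ∂ and `0 ≤ T_g` at the chart point `Q = δ²/(Y²−t²)`, `r = (Y+t)/(Y−t)` ⇒ disjunct 4. -/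
theorem tihp_of_GBound_limTg {s g h δ t Y : ℝ} (hs : 0 < s) (hsh : 2 * s ≤ h) (h3 : 3 * h < 2) (hYh : Y ≤ h) (ht : 0 < t) (htY : t < Y)
    (hdrop : Y - s / 4 < t) (hnest : δ ^ 2 + t ^ 2 < Y ^ 2) (hδ : 0 ≤ δ) (hG : GBoundOn g h δ t)
    (hT : 0 ≤ limTg g (δ ^ 2 / (Y ^ 2 - t ^ 2)) ((Y + t) / (Y - t))) :
    ∃ B : ℝ, 1 / (2 * s) < B ∧ ThinBdryDomFormTi 2 (1 - h) h δ t (1 - B / kerIm δ t Y) := by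
  obtain ⟨hm, hr, hQ0, -, et, eY, eδ⟩ := chart_of_datum ht htY hnest
  have hδh : δ < h := by nlinarith
  exact tihp_chart hs hsh (by linarith) hm hr hQ0 hδ hδh eδ et eY (by linarith) hYh (kerIm_pos ht htY hnest) hG hT

/-! ## §3 A-SIDE: the A-sector and A-half-plane disjuncts through K-free bounds `J ≤ j`, `Dl ≤ d` -/

/-- the A-inequalities times `‖K‖·Im K`: `aSecPoly κ = κ(Re K² + Im K²)·c_w + Im K·(Re K·ΔRe + Im K·ΔC)`, `ΔRe = Re K_u(w) − Re K_u(p₀)`, `ΔC = c_{p₀} − c_w`. -/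
def aSecPoly (κ δ t Y ξ b : ℝ) : ℝ :=
  κ * (kerRe δ t Y ^ 2 + kerIm δ t Y ^ 2) * pairCForm δ t ξ b +
    kerIm δ t Y * (kerRe δ t Y * (pairReForm δ t ξ b - pairReForm 0 t ξ b) + kerIm δ t Y * (pairCForm 0 t ξ b - pairCForm δ t ξ b))

/-- ★ A-SIDE, EXACT, UNIFIED (`Im K > 0`): `N_A(u) ≤ ((κ‖K‖ − B)/Im K)·c(u) ⟺ B·‖K‖·c(u) ≤ aSecPoly κ u` (A-sector `B = 0`; A-half-plane `κ = 1`). -/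
theorem footA_dom_iff {κ B δ t Y ξ b : ℝ} (hIK : 0 < kerIm δ t Y) :
    footANumForm δ t Y ξ b ≤ (κ * kerNorm δ t Y - B) / kerIm δ t Y * pairCForm δ t ξ b ↔
      B * kerNorm δ t Y * pairCForm δ t ξ b ≤ aSecPoly κ δ t Y ξ b := by
  have hN : 0 < kerNorm δ t Y := by unfold kerNorm; exact Real.sqrt_pos.2 (by positivity)
  have e : (κ * kerNorm δ t Y - B) * pairCForm δ t ξ b * kerNorm δ t Y =
      κ * (kerRe δ t Y ^ 2 + kerIm δ t Y ^ 2) * pairCForm δ t ξ b - B * kerNorm δ t Y * pairCForm δ t ξ b := by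
    rw [← kerNorm_sq]; ring
  unfold footANumForm aSecPoly
  rw [show (κ * kerNorm δ t Y - B) / kerIm δ t Y * pairCForm δ t ξ b = (κ * kerNorm δ t Y - B) * pairCForm δ t ξ b / kerIm δ t Y by ring,
    le_div_iff₀ hIK, show -((kerRe δ t Y * (pairReForm δ t ξ b - pairReForm 0 t ξ b) +
      kerIm δ t Y * (pairCForm 0 t ξ b - pairCForm δ t ξ b)) / kerNorm δ t Y) * kerIm δ t Y =
      -((kerRe δ t Y * (pairReForm δ t ξ b - pairReForm 0 t ξ b) + kerIm δ t Y * (pairCForm 0 t ξ b - pairCForm δ t ξ b)) * kerIm δ t Y) /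
        kerNorm δ t Y by ring, div_le_iff₀ hN, e]
  constructor <;> intro h <;> linarith

/-- the A-disjuncts as a boundary family of polynomial inequalities. -/
theorem aDom_iff {κ B h δ t Y : ℝ} (hIK : 0 < kerIm δ t Y) :
    ThinBdryDomFormA 2 (1 - h) δ t Y ((κ * kerNorm δ t Y - B) / kerIm δ t Y) ↔
      OnThinBdry h (fun ξ b => B * kerNorm δ t Y * pairCForm δ t ξ b ≤ aSecPoly κ δ t Y ξ b) := by
  rw [thinBdryDomFormA_iff]; unfold OnThinBdry; simp only [footA_dom_iff hIK]

/-- the A-margin with remainder factors (C3 g59's `Φ = Φ⁰·J + Im K²·Dl`): `A_{κ,j,d}(Q,r) = κQW² − 2Q(1−Q)rW·j + r(r−1)²(1−Q)²(κ − d)`. -/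
def limAjd (κ j d Q r : ℝ) : ℝ := κ * Q * limW Q r ^ 2 - 2 * Q * (1 - Q) * r * limW Q r * j + r * (r - 1) ^ 2 * (1 - Q) ^ 2 * (κ - d)

/-- `A_{27/256,1,0} = limA`: #1314's `limA` IS the leading order (`J ≡ 1`, `Dl ≡ 0` at `u = ∞`). -/
theorem limAjd_lead (Q r : ℝ) : limAjd (27 / 256) 1 0 Q r = limA Q r := by unfold limAjd limA kap; ring

/-- `Nk(Q,r) = QW² + r(r−1)²(1−Q)²` — the chart numerator of `‖K‖²` (#1319 `kerNorm_sq_QR`). -/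
def limNk (Q r : ℝ) : ℝ := Q * limW Q r ^ 2 + r * (r - 1) ^ 2 * (1 - Q) ^ 2

/-- the A-half-plane ROOM polynomial: `H_{j,d}(Q,r) = 64·A_{1,j,d}² − Nk·r(1+Qr)²(Q+r)²` (s- and m-free; C3 g59's flat `64X² ≥ k²`). -/
def limHroom (j d Q r : ℝ) : ℝ := 64 * limAjd 1 j d Q r ^ 2 - limNk Q r * (r * ((1 + Q * r) ^ 2 * (Q + r) ^ 2))

/-- `‖K‖²·(r m²(1+Qr)²(Q+r)²) = Nk` in the chart (#1319 `kerNorm_sq_QR` by name). -/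
theorem kerNorm_sq_chart (Q r m δ : ℝ) (hm : 0 < m) (hr : 0 < r) (hQ : 0 ≤ Q) (hδ : δ ^ 2 = Q * r * m ^ 2) :
    kerNorm δ (m * (r - 1) / 2) (m * (r + 1) / 2) ^ 2 * (r * m ^ 2 * (1 + Q * r) ^ 2 * (Q + r) ^ 2) = limNk Q r := by
  rw [kerNorm_sq_QR Q r m δ hm hr hQ hδ]; unfold limNk limW; ring

/-- ★ A-DOOR, POINTWISE: `J ≤ j` (`−t·ΔRe ≤ j·δ·c_w`), `Dl ≤ d` (`c_w − c_{p₀} ≤ d·c_w`), `Re K, Im K ≥ 0` ⇒ `c_w·(κ‖K‖² − j(δ/t)ReK·ImK − d·ImK²) ≤ aSecPoly κ`. -/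
theorem aSecPoly_ge {κ j d δ t Y ξ b : ℝ} (ht : 0 < t) (hRK : 0 ≤ kerRe δ t Y) (hIK : 0 ≤ kerIm δ t Y)
    (hJ : -(t * (pairReForm δ t ξ b - pairReForm 0 t ξ b)) ≤ j * δ * pairCForm δ t ξ b)
    (hD : pairCForm δ t ξ b - pairCForm 0 t ξ b ≤ d * pairCForm δ t ξ b) :
    pairCForm δ t ξ b * (κ * (kerRe δ t Y ^ 2 + kerIm δ t Y ^ 2) - j * (δ / t) * kerRe δ t Y * kerIm δ t Y - d * kerIm δ t Y ^ 2) ≤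
      aSecPoly κ δ t Y ξ b := by
  have e : aSecPoly κ δ t Y ξ b - pairCForm δ t ξ b * (κ * (kerRe δ t Y ^ 2 + kerIm δ t Y ^ 2) - j * (δ / t) * kerRe δ t Y * kerIm δ t Y -
      d * kerIm δ t Y ^ 2) = kerIm δ t Y * kerRe δ t Y * ((t * (pairReForm δ t ξ b - pairReForm 0 t ξ b) + j * δ * pairCForm δ t ξ b) / t) +
      kerIm δ t Y ^ 2 * (pairCForm 0 t ξ b - pairCForm δ t ξ b + d * pairCForm δ t ξ b) := by
    unfold aSecPoly; field_simp; ring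
  have h1 : 0 ≤ (t * (pairReForm δ t ξ b - pairReForm 0 t ξ b) + j * δ * pairCForm δ t ξ b) / t := div_nonneg (by linarith) ht.le
  rw [← sub_nonneg, e]
  exact add_nonneg (mul_nonneg (mul_nonneg hIK hRK) h1) (mul_nonneg (sq_nonneg _) (by linarith))

/-- CHART IDENTITY: `κ‖K‖² − j·(δ/t)·Re K·Im K − d·Im K² = A_{κ,j,d}(Q,r)/(r m²(1+Qr)²(Q+r)²)` (#1319 `phi0_QR`, `kerIm_QR`, `kerNorm_sq_QR`). -/
theorem bracket_chart (κ j d Q r m δ : ℝ) (hm : 0 < m) (hr : 1 < r) (hQ : 0 ≤ Q) (hδ : δ ^ 2 = Q * r * m ^ 2) :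
    κ * (kerRe δ (m * (r - 1) / 2) (m * (r + 1) / 2) ^ 2 + kerIm δ (m * (r - 1) / 2) (m * (r + 1) / 2) ^ 2) -
        j * (δ / (m * (r - 1) / 2)) * kerRe δ (m * (r - 1) / 2) (m * (r + 1) / 2) * kerIm δ (m * (r - 1) / 2) (m * (r + 1) / 2) -
        d * kerIm δ (m * (r - 1) / 2) (m * (r + 1) / 2) ^ 2 = limAjd κ j d Q r / (r * m ^ 2 * (1 + Q * r) ^ 2 * (Q + r) ^ 2) := by
  have hr0 : 0 < r := by linarith
  have h1 : 0 < 1 + Q * r := by positivity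
  have h2 : 0 < Q + r := by positivity
  have hD : 0 < r * m ^ 2 * (1 + Q * r) ^ 2 * (Q + r) ^ 2 := by positivity
  have hN : kerRe δ (m * (r - 1) / 2) (m * (r + 1) / 2) ^ 2 + kerIm δ (m * (r - 1) / 2) (m * (r + 1) / 2) ^ 2 =
      limNk Q r / (r * m ^ 2 * (1 + Q * r) ^ 2 * (Q + r) ^ 2) := by
    rw [← kerNorm_sq, eq_div_iff hD.ne']; exact kerNorm_sq_chart Q r m δ hm hr0 hQ hδ
  rw [show j * (δ / (m * (r - 1) / 2)) * kerRe δ (m * (r - 1) / 2) (m * (r + 1) / 2) * kerIm δ (m * (r - 1) / 2) (m * (r + 1) / 2) =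
      j * (δ / (m * (r - 1) / 2) * kerRe δ (m * (r - 1) / 2) (m * (r + 1) / 2) * kerIm δ (m * (r - 1) / 2) (m * (r + 1) / 2)) by ring,
    phi0_QR Q r m δ hm hr hQ hδ, hN, kerIm_QR Q r m δ hm hr0 hQ hδ]
  unfold limAjd limNk limW; field_simp; ring

/-- the K-free A-bound family `J ≤ j` on the thin boundary: `−t·(Re K_u(w) − Re K_u(p₀)) ≤ j·δ·c_w(u)`. -/
def JBoundOn (j h δ t : ℝ) : Prop :=
  OnThinBdry h (fun ξ b => -(t * (pairReForm δ t ξ b - pairReForm 0 t ξ b)) ≤ j * δ * pairCForm δ t ξ b)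

/-- the K-free A-bound family `Dl ≤ d` on the thin boundary: `c_w(u) − c_{p₀}(u) ≤ d·c_w(u)` (i.e. `(1 − d)·Λ(w,u) ≤ Λ(p₀,u)`). -/
def DlBoundOn (d h δ t : ℝ) : Prop :=
  OnThinBdry h (fun ξ b => pairCForm δ t ξ b - pairCForm 0 t ξ b ≤ d * pairCForm δ t ξ b)

/-- ★★ A-DOOR in the chart: `J ≤ j`, `Dl ≤ d` on ∂ and a level `B` with `B·‖K‖ ≤ A_{κ,j,d}/(r m²(1+Qr)²(Q+r)²)` ⇒ A-domination at `σ = (κ‖K‖−B)/Im K`. -/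
theorem aDoor_chart {κ B j d h Q r m δ t Y : ℝ} (hh1 : h ≤ 1) (hm : 0 < m) (hr : 1 < r) (hQ : 0 ≤ Q) (hδ : 0 ≤ δ) (hδh : δ < h)
    (hδQ : δ ^ 2 = Q * r * m ^ 2) (et : t = m * (r - 1) / 2) (eY : Y = m * (r + 1) / 2) (hIK : 0 < kerIm δ t Y)
    (hJ : JBoundOn j h δ t) (hD : DlBoundOn d h δ t) (hB : B * kerNorm δ t Y ≤ limAjd κ j d Q r / (r * m ^ 2 * (1 + Q * r) ^ 2 * (Q + r) ^ 2)) :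
    ThinBdryDomFormA 2 (1 - h) δ t Y ((κ * kerNorm δ t Y - B) / kerIm δ t Y) := by
  have hr0 : 0 < r := by linarith
  have hr1 : 0 < r - 1 := by linarith
  have ht : 0 < t := by rw [et]; positivity
  have hRK : 0 ≤ kerRe δ t Y := by
    rw [et, eY, kerRe_QR Q r m δ hm hr0 hQ hδQ]
    have h1 : 0 < 1 + Q * r := by positivity
    have h2 : 0 < Q + r := by positivity
    positivity
  have hbr : κ * (kerRe δ t Y ^ 2 + kerIm δ t Y ^ 2) - j * (δ / t) * kerRe δ t Y * kerIm δ t Y - d * kerIm δ t Y ^ 2 =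
      limAjd κ j d Q r / (r * m ^ 2 * (1 + Q * r) ^ 2 * (Q + r) ^ 2) := by
    rw [et, eY]; exact bracket_chart κ j d Q r m δ hm hr hQ hδQ
  rw [aDom_iff hIK]
  refine (hJ.and hD).mono hh1 fun ξ b hξ hb0 hb hpt => ?_
  have hc : 0 ≤ pairCForm δ t ξ b := (pairCForm_pos ht (by nlinarith [sq_lt_bdry hδ hδh hξ hb0 hb, sq_nonneg t])).le
  calc B * kerNorm δ t Y * pairCForm δ t ξ b ≤ limAjd κ j d Q r / (r * m ^ 2 * (1 + Q * r) ^ 2 * (Q + r) ^ 2) * pairCForm δ t ξ b :=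
        mul_le_mul_of_nonneg_right hB hc
    _ = pairCForm δ t ξ b * (κ * (kerRe δ t Y ^ 2 + kerIm δ t Y ^ 2) - j * (δ / t) * kerRe δ t Y * kerIm δ t Y - d * kerIm δ t Y ^ 2) := by
        rw [hbr, mul_comm]
    _ ≤ aSecPoly κ δ t Y ξ b := aSecPoly_ge ht hRK hIK.le hpt.1 hpt.2

/-- A-half-plane door in the chart: witness `B = Br₁/‖K‖`, ROOM from `m < s/4` and `0 ≤ H_{j,d}(Q,r)`. -/
theorem ahp_chart {s j d h Q r m δ t Y : ℝ} (hs : 0 < s) (hh1 : h ≤ 1) (hm : 0 < m) (hr : 1 < r) (hQ : 0 ≤ Q) (hδ : 0 ≤ δ) (hδh : δ < h)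
    (hδQ : δ ^ 2 = Q * r * m ^ 2) (et : t = m * (r - 1) / 2) (eY : Y = m * (r + 1) / 2) (hms : m < s / 4) (hIK : 0 < kerIm δ t Y)
    (hJ : JBoundOn j h δ t) (hD : DlBoundOn d h δ t) (hA : 0 < limAjd 1 j d Q r) (hH : 0 ≤ limHroom j d Q r) :
    ∃ B : ℝ, 1 / (2 * s) < B ∧ ThinBdryDomFormA 2 (1 - h) δ t Y ((kerNorm δ t Y - B) / kerIm δ t Y) := by
  have hr0 : 0 < r := by linarith
  have h2 : 0 < Q + r := by positivity
  have hDen : 0 < r * m ^ 2 * (1 + Q * r) ^ 2 * (Q + r) ^ 2 := by positivity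
  have hN : 0 < kerNorm δ t Y := by unfold kerNorm; exact Real.sqrt_pos.2 (by positivity)
  have hNk : kerNorm δ t Y ^ 2 * (r * m ^ 2 * (1 + Q * r) ^ 2 * (Q + r) ^ 2) = limNk Q r := by
    rw [et, eY]; exact kerNorm_sq_chart Q r m δ hm hr0 hQ hδQ
  unfold limHroom at hH
  have hsq : (kerNorm δ t Y * (r * m ^ 2 * (1 + Q * r) ^ 2 * (Q + r) ^ 2)) ^ 2 < (2 * s * limAjd 1 j d Q r) ^ 2 :=
    calc (kerNorm δ t Y * (r * m ^ 2 * (1 + Q * r) ^ 2 * (Q + r) ^ 2)) ^ 2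
          = limNk Q r * (r * ((1 + Q * r) ^ 2 * (Q + r) ^ 2)) * m ^ 2 := by rw [mul_pow, ← hNk]; ring
      _ ≤ 64 * limAjd 1 j d Q r ^ 2 * m ^ 2 := mul_le_mul_of_nonneg_right (by linarith) (sq_nonneg m)
      _ < 64 * limAjd 1 j d Q r ^ 2 * (s / 4) ^ 2 := by gcongr
      _ = (2 * s * limAjd 1 j d Q r) ^ 2 := by ring
  have hlt : kerNorm δ t Y * (r * m ^ 2 * (1 + Q * r) ^ 2 * (Q + r) ^ 2) < 2 * s * limAjd 1 j d Q r := by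
    by_contra hle
    rw [not_lt] at hle
    nlinarith [mul_self_le_mul_self (by positivity : (0 : ℝ) ≤ 2 * s * limAjd 1 j d Q r) hle]
  refine ⟨limAjd 1 j d Q r / (r * m ^ 2 * (1 + Q * r) ^ 2 * (Q + r) ^ 2) / kerNorm δ t Y, ?_, ?_⟩
  · rw [lt_div_iff₀ hN, lt_div_iff₀ hDen]
    calc 1 / (2 * s) * kerNorm δ t Y * (r * m ^ 2 * (1 + Q * r) ^ 2 * (Q + r) ^ 2)
          = kerNorm δ t Y * (r * m ^ 2 * (1 + Q * r) ^ 2 * (Q + r) ^ 2) / (2 * s) := by ring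
      _ < 2 * s * limAjd 1 j d Q r / (2 * s) := by gcongr
      _ = limAjd 1 j d Q r := by field_simp
  · rw [show kerNorm δ t Y - _ = (1 * kerNorm δ t Y - limAjd 1 j d Q r / (r * m ^ 2 * (1 + Q * r) ^ 2 * (Q + r) ^ 2) / kerNorm δ t Y) by
      rw [one_mul]]
    exact aDoor_chart hh1 hm hr hQ hδ hδh hδQ et eY hIK hJ hD (le_of_eq (div_mul_cancel₀ _ hN.ne'))

/-- ★★★ A-SECTOR OF RECORD over the NF binders: `J ≤ j`, `Dl ≤ d` on ∂ and `0 ≤ A_{27/256,j,d}(Q, r)` at the chart point give the 1st disjunct. -/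
theorem asec_of_JDl {j d h δ t Y : ℝ} (h3 : 3 * h < 2) (hYh : Y ≤ h) (ht : 0 < t) (htY : t < Y) (hnest : δ ^ 2 + t ^ 2 < Y ^ 2) (hδ : 0 ≤ δ)
    (hJ : JBoundOn j h δ t) (hD : DlBoundOn d h δ t) (hA : 0 ≤ limAjd (27 / 256) j d (δ ^ 2 / (Y ^ 2 - t ^ 2)) ((Y + t) / (Y - t))) :
    ThinBdryDomFormA 2 (1 - h) δ t Y (27 / 256 * kerNorm δ t Y / kerIm δ t Y) := by
  obtain ⟨hm, hr, hQ0, -, et, eY, eδ⟩ := chart_of_datum ht htY hnest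
  have hδh : δ < h := by nlinarith
  have h2 : 0 < δ ^ 2 / (Y ^ 2 - t ^ 2) + (Y + t) / (Y - t) := by linarith
  rw [show 27 / 256 * kerNorm δ t Y / kerIm δ t Y = (27 / 256 * kerNorm δ t Y - 0) / kerIm δ t Y by ring]
  exact aDoor_chart (by linarith) hm hr hQ0 hδ hδh eδ et eY (kerIm_pos ht htY hnest) hJ hD (by rw [zero_mul]; positivity)

/-- ★★★ A-HALF-PLANE OF RECORD over the NF binders (C3 g59 RESULT-2's hole-carrier): `J ≤ j`, `Dl ≤ d` on ∂, `0 < A_{1,j,d}`, `0 ≤ H_{j,d}` ⇒ disjunct 2. -/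
theorem ahp_of_JDl {s j d h δ t Y : ℝ} (hs : 0 < s) (h3 : 3 * h < 2) (hYh : Y ≤ h) (ht : 0 < t) (htY : t < Y) (hdrop : Y - s / 4 < t)
    (hnest : δ ^ 2 + t ^ 2 < Y ^ 2) (hδ : 0 ≤ δ) (hJ : JBoundOn j h δ t) (hD : DlBoundOn d h δ t)
    (hA : 0 < limAjd 1 j d (δ ^ 2 / (Y ^ 2 - t ^ 2)) ((Y + t) / (Y - t))) (hH : 0 ≤ limHroom j d (δ ^ 2 / (Y ^ 2 - t ^ 2)) ((Y + t) / (Y - t))) :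
    ∃ B : ℝ, 1 / (2 * s) < B ∧ ThinBdryDomFormA 2 (1 - h) δ t Y ((kerNorm δ t Y - B) / kerIm δ t Y) := by
  obtain ⟨hm, hr, hQ0, -, et, eY, eδ⟩ := chart_of_datum ht htY hnest
  have hδh : δ < h := by nlinarith
  exact ahp_chart hs (by linarith) hm hr hQ0 hδ hδh eδ et eY (by linarith) (kerIm_pos ht htY hnest) hJ hD hA hH

end RhW08.MenuThinTop

end
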